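import Summits.Ventures.Crystal3D.Theorems.StickyWulffConstantCoaxialWallLawAutomatonEnds
import Summits.Ventures.Crystal3D.Theorems.StickyWulffConstantCoaxialWallLawAutomatonCount
import Summits.Ventures.Crystal3D.Theorems.StickyWulffConstantGenericWallFloorTwinFrame
import HarnessLib

/-!
# The word automaton of the co-axial cell, III: sources ≤ ends + exits, and every end pays

HONEST FRAMING. Part of the venture `Summits/Ventures/Crystal3D` (cell `crystal3d-full`), helper for the
crux `CoaxialWallLaw` (stmt-Ventures-19481) of `route-Ventures-StickyWulffConstant`, REGISTERED line
`WallLedgerF` (planner cf-p1 gen 16), open stub `stub_coaxialTwoSlabAdhesion` (general fillings).  Brick W3 of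
the v2 (NET) line automaton (memo F-NET-AUTOMATON-v2 §7, evidence on the crux item).  Rung credit only; F-C1 not
moved.

* `card_sources_le_ends_add_exits` — pure counting: for a finite state set `V`, a move map `f` injective on
  the moving states together with a set `S` of SOURCE states (disjoint from `V`, images in `V`),
  `#S ≤ #{v ∈ V not moving} + #{v ∈ V moving, f v ∉ V}` (paths of an injective partial map: no monotonicity).
* `word_end_pays` — a state of the word automaton (ball `b ∈ X` with a `60°` triangle of `F κ`-neighbours and
  `b − d κ ∈ X`, `d κ = F κ u`) that is NOT moving (no full shell, no twin-dozen reading `m` with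
  `⟪d κ, m⟫ ∈ {√(2/3), 0}`) has a ball with at most eleven contacts within distance `1` (`line_step`; a reading
  with `⟪d κ, m⟫ = −√(2/3)` would make `b − d κ` a far ball).  Inputs `KissingGap δ`, `KissingClassification δ`
  by name.
* `card_ends_le_mul` — hence `#ENDS ≤ 13 · M · #{z ∈ X : deg z ≤ 11, zlo − 1 ≤ z₂ ≤ zcut + 1}` when every ball
  carries at most `M` states (`card_near_le_thirteen`).

WHAT THIS IS NOT: not the stub; exits and the instantiation are the next bricks; F-C1 not moved.
-/

noncomputable section

namespace Summit.Ventures.Crystal3D.Theorems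

open Summit.Ventures.Crystal3D Finset
open Literature.MathematicalPhysics.StatisticalMechanics (fccStacking)
open scoped InnerProductSpace

/-- **Sources ≤ ends + exits** for an injective partial self-map of a finite set.  See the module docstring. -/
theorem card_sources_le_ends_add_exits {α : Type*} [DecidableEq α] (V S : Finset α) (f : α → α)
    (mov : α → Prop) [DecidablePred mov]
    (hinj : Set.InjOn f {v | (v ∈ V ∨ v ∈ S) ∧ mov v})
    (hdisj : Disjoint S V) (hS : ∀ s ∈ S, mov s ∧ f s ∈ V) :
    S.card ≤ (V.filter fun v => ¬ mov v).card + ((V.filter fun v => mov v).filter fun v => f v ∉ V).card := by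
  set D := (V.filter fun v => mov v).filter fun v => f v ∈ V with hD
  have hDV : D ⊆ V := fun v hv => (mem_filter.1 (mem_filter.1 hv).1).1
  have hinjD : Set.InjOn f ↑D := by
    intro x hx y hy hxy
    have hx' := mem_filter.1 (mem_filter.1 (Finset.mem_coe.1 hx)).1
    have hy' := mem_filter.1 (mem_filter.1 (Finset.mem_coe.1 hy)).1
    exact hinj ⟨Or.inl hx'.1, hx'.2⟩ ⟨Or.inl hy'.1, hy'.2⟩ hxy
  have himg : D.image f ⊆ V := by
    intro y hy
    obtain ⟨x, hx, rfl⟩ := mem_image.1 hy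
    exact (mem_filter.1 hx).2
  have hcount := card_sdiff_eq_card_sdiff_image V D f hDV hinjD himg
  -- the images of the sources avoid the images of `D`
  have hSimg : S.image f ⊆ V \ D.image f := by
    intro y hy
    obtain ⟨s, hs, rfl⟩ := mem_image.1 hy
    rw [mem_sdiff]
    refine ⟨(hS s hs).2, fun h => ?_⟩
    obtain ⟨x, hx, hxs⟩ := mem_image.1 h
    have hx' := mem_filter.1 (mem_filter.1 hx).1
    have heq : x = s := hinj ⟨Or.inl hx'.1, hx'.2⟩ ⟨Or.inr hs, (hS s hs).1⟩ hxs
    rw [heq] at hx'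
    exact Finset.disjoint_left.1 hdisj hs hx'.1
  have hSinj : Set.InjOn f ↑S := fun x hx y hy hxy =>
    hinj ⟨Or.inr (Finset.mem_coe.1 hx), (hS x hx).1⟩ ⟨Or.inr (Finset.mem_coe.1 hy), (hS y hy).1⟩ hxy
  have h1 : S.card = (S.image f).card := (card_image_of_injOn hSinj).symm
  have h2 : (S.image f).card ≤ (V \ D.image f).card := card_le_card hSimg
  -- `V ∖ D` splits into the non-moving states and the exits
  have h3 : (V \ D).card ≤ (V.filter fun v => ¬ mov v).card +
      ((V.filter fun v => mov v).filter fun v => f v ∉ V).card := by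
    have hsub : V \ D ⊆ (V.filter fun v => ¬ mov v) ∪ ((V.filter fun v => mov v).filter fun v => f v ∉ V) := by
      intro v hv
      rw [mem_sdiff] at hv
      rw [mem_union, mem_filter, mem_filter, mem_filter]
      by_cases hm : mov v
      · right
        refine ⟨⟨hv.1, hm⟩, fun h => hv.2 ?_⟩
        rw [hD, mem_filter, mem_filter]
        exact ⟨⟨hv.1, hm⟩, h⟩
      · exact Or.inl ⟨hv.1, hm⟩
    exact (card_le_card hsub).trans (card_union_le _ _)
  omega

variable {X : Finset (EuclideanSpace ℝ (Fin 3))}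

/-- **Every end pays.**  See the module docstring. -/
theorem word_end_pays {δ : ℝ} (hg : KissingGap δ) (hc : KissingClassification δ)
    (hX : ∀ p ∈ X, ∀ q ∈ X, p ≠ q → 1 ≤ dist p q)
    (G : EuclideanSpace ℝ (Fin 3) ≃ₗᵢ[ℝ] EuclideanSpace ℝ (Fin 3)) {b d : EuclideanSpace ℝ (Fin 3)}
    (hb : b ∈ X) (hd : ∃ u ∈ fccSlots, d = G u) (hback : b - d ∈ X)
    (htri : ∃ a ∈ fccSlots, ∃ a' ∈ fccSlots, ∃ a'' ∈ fccSlots,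
      ⟪a, a'⟫_ℝ = 1 / 2 ∧ ⟪a, a''⟫_ℝ = 1 / 2 ∧ ⟪a', a''⟫_ℝ = 1 / 2 ∧
      b + G a ∈ X ∧ b + G a' ∈ X ∧ b + G a'' ∈ X)
    (hnf : ¬ ∀ w ∈ fccSlots, b + G w ∈ X)
    (hnt : ¬ ∃ m : EuclideanSpace ℝ (Fin 3), ‖m‖ = 1 ∧
      (∀ w ∈ fccSlots, ⟪G w, m⟫_ℝ = 0 ∨ ⟪G w, m⟫_ℝ = Real.sqrt (2 / 3) ∨ ⟪G w, m⟫_ℝ = -Real.sqrt (2 / 3)) ∧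
      (∀ w ∈ fccSlots, ⟪G w, m⟫_ℝ ≤ 0 → b + G w ∈ X) ∧
      (∀ w ∈ fccSlots, ⟪G w, m⟫_ℝ < 0 → b + (G w - (2 * ⟪G w, m⟫_ℝ) • m) ∈ X) ∧
      (∀ w ∈ fccSlots, 0 < ⟪G w, m⟫_ℝ → b + G w ∉ X) ∧
      (⟪d, m⟫_ℝ = Real.sqrt (2 / 3) ∨ ⟪d, m⟫_ℝ = 0)) :
    ∃ z ∈ X, dist b z ≤ 1 ∧ (X.filter fun q => dist z q = 1).card ≤ 11 := by
  have hr : 0 < Real.sqrt (2 / 3) := Real.sqrt_pos.2 (by norm_num)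
  obtain ⟨a, ha, a', ha', a'', ha'', i1, i2, i3, haX, ha'X, ha''X⟩ := htri
  have hind := linearIndependent_of_pairwise_half ha ha' ha'' i1 i2 i3
  rcases line_step hg hc hX hb G ha ha' ha'' hind haX ha'X ha''X with hpay | hfull | htw
  · exact hpay
  · exact absurd hfull hnf
  · obtain ⟨m, hm, hmenu, hown, hmir, hfar, -, -, -⟩ := htw
    obtain ⟨u, hu, rfl⟩ := hd
    exfalso
    rcases hmenu u hu with h0 | hpos | hneg
    · exact hnt ⟨m, hm, hmenu, hown, hmir, hfar, Or.inr h0⟩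
    · exact hnt ⟨m, hm, hmenu, hown, hmir, hfar, Or.inl hpos⟩
    · -- `⟪G u, m⟫ = −√(2/3)`: the predecessor `b − G u = b + G(−u)` would be a far ball
      have h := hfar (-u) (neg_mem_fccSlots hu) (by rw [map_neg, inner_neg_left, hneg, neg_neg]; exact hr)
      rw [map_neg, ← sub_eq_add_neg] at h
      exact h hback

section Charging

variable {K : Type*}

open scoped Classical in
/-- **Ends are few: at most `13·M` per payer.**  If every end has a payer within distance `1` and every ball
carries at most `M` states of `V`, then `#ENDS ≤ 13 · M · #payers` (heights widened by one). -/
theorem card_ends_le_mul (hX : ∀ p ∈ X, ∀ q ∈ X, p ≠ q → 1 ≤ dist p q)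
    (V E : Finset (EuclideanSpace ℝ (Fin 3) × K)) {zlo zcut : ℝ} {M : ℕ}
    (hEV : E ⊆ V) (hV : ∀ v ∈ V, v.1 ∈ X ∧ zlo ≤ v.1 2 ∧ v.1 2 < zcut)
    (hmult : ∀ b ∈ X, (V.filter fun v => v.1 = b).card ≤ M)
    (hpay : ∀ v ∈ E, ∃ z ∈ X, dist v.1 z ≤ 1 ∧ (X.filter fun q => dist z q = 1).card ≤ 11) :
    E.card ≤ 13 * M * (X.filter fun z => (X.filter fun q => dist z q = 1).card ≤ 11 ∧
        zlo - 1 ≤ z 2 ∧ z 2 ≤ zcut + 1).card := by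
  set U := X.filter fun z => (X.filter fun q => dist z q = 1).card ≤ 11 ∧ zlo - 1 ≤ z 2 ∧ z 2 ≤ zcut + 1
    with hU
  -- every end lies over a payer of `U`
  have hcover : E ⊆ U.biUnion fun z => (X.filter fun b => dist b z ≤ 1).biUnion fun b => V.filter fun v => v.1 = b := by
    intro v hv
    obtain ⟨z, hz, hdz, hdeg⟩ := hpay v hv
    obtain ⟨hvX, hzlo, hzcut⟩ := hV v (hEV hv)
    rw [mem_biUnion]
    refine ⟨z, ?_, ?_⟩
    · have h2 : (v.1 2 - z 2) ^ 2 ≤ 1 := by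
        have h1 := sq_sub_apply_le_dist_sq v.1 z 2
        have h0 : 0 ≤ dist v.1 z := dist_nonneg
        nlinarith
      have h2' : |v.1 2 - z 2| ≤ 1 := by rw [← sq_le_one_iff_abs_le_one]; exact h2
      obtain ⟨h2a, h2b⟩ := abs_le.1 h2'
      rw [hU, mem_filter]
      exact ⟨hz, hdeg, by linarith, by linarith⟩
    · rw [mem_biUnion]
      exact ⟨v.1, mem_filter.2 ⟨hvX, hdz⟩, mem_filter.2 ⟨hEV hv, rfl⟩⟩
  refine (card_le_card hcover).trans (card_biUnion_le.trans ?_)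
  have hfib : ∀ z ∈ U, ((X.filter fun b => dist b z ≤ 1).biUnion fun b => V.filter fun v => v.1 = b).card ≤ 13 * M := by
    intro z hz
    refine card_biUnion_le.trans ?_
    have h13 := card_near_le_thirteen X hX (mem_filter.1 hz).1 (z := z)
    calc ∑ b ∈ X.filter (fun b => dist b z ≤ 1), (V.filter fun v => v.1 = b).card
        ≤ ∑ b ∈ X.filter (fun b => dist b z ≤ 1), M :=
          sum_le_sum fun b hb => hmult b (mem_filter.1 hb).1
      _ = (X.filter fun b => dist b z ≤ 1).card * M := by rw [sum_const, smul_eq_mul]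
      _ ≤ 13 * M := Nat.mul_le_mul_right M h13
  calc ∑ z ∈ U, ((X.filter fun b => dist b z ≤ 1).biUnion fun b => V.filter fun v => v.1 = b).card
      ≤ ∑ z ∈ U, 13 * M := sum_le_sum hfib
    _ = 13 * M * U.card := by rw [sum_const, smul_eq_mul, mul_comm]

end Charging

end Summit.Ventures.Crystal3D.Theorems

end
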